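import Summits.SmoothPoincare4.SmoothPoincare4.Theses.CylinderEntropy
import Summits.SmoothPoincare4.SmoothPoincare4.Theorems.CylinderEntropyCylinderRungTwoNullSurvivorsDie
import Summits.SmoothPoincare4.SmoothPoincare4.Theorems.CylinderEntropyCylinderRungTwoPortReduction
import Summits.SmoothPoincare4.SmoothPoincare4.Theorems.CylinderEntropyRungTwoOfSurgeryResolution
import Summits.SmoothPoincare4.SmoothPoincare4.Theorems.CylinderEntropyCylinderRungTwoSurgeryDefs
import HarnessLib

/-!
# Route `CylinderEntropy`, crux `CylinderRungTwo` (stmt-SmoothPoincare4-7631), line `killing-flux`: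
# THE POCKET PORT — the route's research item `CylinderSurgeryResolution` (stmt-SmoothPoincare4-18045) is exactly ONE statement

Lead c9 glue.  After r21 the crux `CylinderRungTwo` hinges on the route item `CylinderSurgeryResolution` (X₁, item 18045) by name
(`cylinderRungTwo_of_resolution_cor15b_certificates`, `Theorems/CylinderEntropyCylinderRungTwoPortReduction.lean`).  The planner's
registered skeleton of X₁ (`Cruxes/CylinderRungTwo/Lines/x1_surgery_port.lean`) still cuts X₁ into TWO stubs: the port proper
`stub_surgeryFlowOrNullAll` whose null branch records only the ZERO VERTICAL FLUX of a null survivor, and the flow-free GMT lemma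
`stub_nullThinStatic` that kills such survivors — an XL statement nobody needs any more.  This file certifies the one-stub cut:

* `PocketPortAll` is not a definition but the displayed hypothesis of `cylinderSurgeryResolution_of_pocketPort`: for every compact
  connected `M` and every thin (`λ_cyl < 4/e`) end-separating embedding `ι : M → N = S⁴ × ℝ`, EITHER some slice of `M` is resolved
  by a mean curvature flow with neck surgery in `N` (`CylNeckSurgeryResolvable`) OR some compact connected carrier has an immortal
  thin smooth cylinder flow whose slices never separate the ends and each have a POCKET (a point of the complement that cannot be
  joined, inside the complement, to the lower end) — literally the lead's registered research stub `stub_cylinderSurgeryFlowOrNull`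
  with `M ≃ₕ S⁴` replaced by `[CompactSpace M] [ConnectedSpace M]`; the pocket is what the surgery bookkeeping of
  Chodosh–Mantoulidis–Schulze / Daniels-Holgate produces when re-run in `N` (the capped null-homologous side of a neck bounds);
* `cylinderSurgeryResolution_of_pocketPort : PocketPortAll → CylinderSurgeryResolution` — NULL SURVIVORS DIE
  (`helper_nullSurvivorsDiePocket`, p150352, all compact connected carriers) kills the second disjunct, and a
  `CylNeckSurgeryResolvable` slice lies in every predicate closed under the six surgery rules (`leastPredicate_of_cylNeckSurgeryResolvable`,
  induction over the tree);
* `pocketPort_of_cylinderSurgeryResolution` — the converse (first disjunct, through the landed `resolvable_of_surgeryResolution`),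
  so the two statements are EQUIVALENT (`cylinderSurgeryResolution_iff_pocketPort`) and X₁ carries no GMT residual;
* `cylinderRungTwo_of_pocketPort_cor15b_certificates` — the crux's end state re-based on the pocket port:
  `CylinderRungTwo ⇐ {PocketPortAll (research), Cor. 1.5 (b) (published), kernel certificates (computational)}`.

References: O. Chodosh, C. Mantoulidis, F. Schulze, *Mean curvature flow with generic low-entropy initial data II*, Duke Math. J.
174 (2025), Thm. 1.13, Cor. 1.19; J. M. Daniels-Holgate, *Approximation of mean curvature flow with generic singularities by smooth
flows with surgery*, Adv. Math. 410 (2022), Thm. 1.3, §2.1 Def. 2.18–2.20.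
-/

noncomputable section

-- the prescribed namespace `Summit.SmoothPoincare4.SmoothPoincare4.…` repeats `SmoothPoincare4`
set_option linter.dupNamespace false

open MeasureTheory Set Function
open scoped Manifold ContDiff ENNReal Topology BigOperators ContinuousMap

namespace Summit.SmoothPoincare4.SmoothPoincare4.Cruxes.CylinderRungTwo.KillingFlux

open Literature.Geometry.Riemannian
open Literature.Geometry.Riemannian.SphericalCylinderEntropy (cylEntropy)
open Literature.Topology.FourManifolds
open Summit.SmoothPoincare4.SmoothPoincare4.Theses.CylinderEntropy (CylinderRungTwo CylinderSurgeryResolution)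

/-- **A resolved slice lies in the least rule-closed predicate.**  If `CylNeckSurgeryResolvable M κ` then `Q M κ` for every
predicate `Q` on (closed 4-manifold, slice) pairs closed under the six rules of the surgery tree (discard · flow · reparametrise ·
cut a separating neck · cut a non-separating neck · immortal thin separating flow) — induction over the tree, the six constructors
being the six rules; the statement after the colon is the matrix of the route decl `CylinderSurgeryResolution` with its
`haveI`/`letI` prefixes. [cite: DanielsHolgate2022, §2.1 Def. 2.18–2.20] -/
theorem leastPredicate_of_cylNeckSurgeryResolvable {M : Type} [TopologicalSpace M]
    [ChartedSpace (EuclideanSpace ℝ (Fin 4)) M] {κ : M → EuclideanSpace ℝ (Fin 6)} (h : CylNeckSurgeryResolvable M κ) :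
    haveI : Fact (Module.finrank ℝ (EuclideanSpace ℝ (Fin 4)) = 3 + 1) := ⟨finrank_euclideanSpace_fin⟩
    letI g := Literature.Geometry.Riemannian.euclideanMetric (EuclideanSpace ℝ (Fin 6))
    ∀ Q : (∀ (P : Type) [TopologicalSpace P] [ChartedSpace (EuclideanSpace ℝ (Fin 4)) P], (P → EuclideanSpace ℝ (Fin 6)) → Prop),
      (∀ (P : Type) [TopologicalSpace P] [ChartedSpace (EuclideanSpace ℝ (Fin 4)) P],
          Literature.Geometry.Riemannian.IsMCFDiscardedComponent P → ∀ κ' : P → EuclideanSpace ℝ (Fin 6), Q P κ') →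
      (∀ (P : Type) [TopologicalSpace P] [T2Space P] [ChartedSpace (EuclideanSpace ℝ (Fin 4)) P] [IsManifold (𝓡 4) ∞ P]
          (F ν : ℝ → P → EuclideanSpace ℝ (Fin 6)) (T₀ T₁ : ℝ), T₀ < T₁ →
          (∃ U : Set ℝ, IsOpen U ∧ Set.Icc T₀ T₁ ⊆ U ∧
            ContMDiffOn (𝓘(ℝ, ℝ).prod (𝓡 4)) (𝓡 6) ∞ (fun q : ℝ × P => F q.1 q.2) (U ×ˢ Set.univ)) →
          (∀ t ∈ Set.Icc T₀ T₁, Manifold.IsSmoothEmbedding (𝓡 4) (𝓡 6) ∞ (F t)) →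
          (∀ t ∈ Set.Icc T₀ T₁, ∀ x, ∑ i : Fin 5, F t x (Fin.castSucc i) ^ 2 = 1) →
          ∀ hi : (∀ t ∈ Set.Icc T₀ T₁, g.IsSpacelikeImmersion (𝓡 4) (F t)),
          (∀ t ∈ Set.Icc T₀ T₁, g.IsUnitNormal (𝓡 4) (F t) (ν t) 1) →
          (∀ t ∈ Set.Icc T₀ T₁, ∀ x, ∑ i : Fin 5, ν t x (Fin.castSucc i) * F t x (Fin.castSucc i) = 0) →
          (∀ t ∈ Set.Icc T₀ T₁, ContMDiff (𝓡 4) (𝓡 6) ∞ (ν t)) →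
          (∀ t (ht : t ∈ Set.Icc T₀ T₁) (x : P), mfderiv 𝓘(ℝ, ℝ) (𝓡 6) (fun s => F s x) t (1 : ℝ) =
            -(g.meanCurvature (F t) Literature.Geometry.Lorentzian.PseudoRiemannianMetric.contMDiff_pullbackBilin_holds
              (hi t ht) (ν t) x) • ν t x) →
          Q P (F T₁) → Q P (F T₀)) →
      (∀ (P P' : Type) [TopologicalSpace P] [ChartedSpace (EuclideanSpace ℝ (Fin 4)) P] [TopologicalSpace P']
          [ChartedSpace (EuclideanSpace ℝ (Fin 4)) P'] [IsManifold (𝓡 4) ∞ P'] (κ' : P → EuclideanSpace ℝ (Fin 6))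
          (e : P ≃ₘ⟮𝓡 4, 𝓡 4⟯ P'), Q P κ' → Q P' (κ' ∘ e.symm)) →
      (∀ (P : Type) [TopologicalSpace P] [T2Space P] [ChartedSpace (EuclideanSpace ℝ (Fin 4)) P] [IsManifold (𝓡 4) ∞ P]
          (κ' : P → EuclideanSpace ℝ (Fin 6)) (ψ : (Metric.sphere (0 : EuclideanSpace ℝ (Fin 4)) 1) × ℝ → P)
          (D₁ : Literature.Topology.FourManifolds.NeckCapData 3 ψ)
          (D₂ : Literature.Topology.FourManifolds.NeckCapData 3 (fun q => ψ (q.1, -q.2))),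
          Disjoint (D₁.side : Set P) D₂.side → (∀ p : P, p ∉ D₁.side → p ∉ D₂.side → ∃ θ, ψ (θ, 0) = p) →
          ∀ (κ₁ : D₁.Capped → EuclideanSpace ℝ (Fin 6)) (κ₂ : D₂.Capped → EuclideanSpace ℝ (Fin 6)),
          Q D₁.Capped κ₁ → Q D₂.Capped κ₂ → Q P κ') →
      (∀ (P : Type) [TopologicalSpace P] [T2Space P] [ChartedSpace (EuclideanSpace ℝ (Fin 4)) P] [IsManifold (𝓡 4) ∞ P]
          (κ' : P → EuclideanSpace ℝ (Fin 6)) (ψ : (Metric.sphere (0 : EuclideanSpace ℝ (Fin 4)) 1) × ℝ → P)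
          (hψ : Manifold.IsSmoothEmbedding ((𝓡 3).prod 𝓘(ℝ, ℝ)) (𝓡 4) ∞ ψ) (ho : IsOpen (Set.range ψ)),
          IsPreconnected (ψ '' (Set.univ ×ˢ ({0} : Set ℝ)))ᶜ →
          ∀ μ : Literature.Topology.FourManifolds.DoubleCap.M hψ ho → EuclideanSpace ℝ (Fin 6),
          Q (Literature.Topology.FourManifolds.DoubleCap.M hψ ho) μ → Q P κ') →
      (∀ (P : Type) [TopologicalSpace P] [T2Space P] [SecondCountableTopology P] [ChartedSpace (EuclideanSpace ℝ (Fin 4)) P]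
          [IsManifold (𝓡 4) ∞ P] [CompactSpace P] [ConnectedSpace P] (F ν : ℝ → P → EuclideanSpace ℝ (Fin 6)) (T : ℝ),
          IsCylinderMCF P F ν T → (∀ t, T ≤ t → SeparatesEnds (Set.range (F t))) →
          (∀ t, T ≤ t → cylEntropy (Set.range (F t)) < 2) → Q P (F T)) →
      Q M κ := by
  intro Q h1 h2 h3 h4 h5 h6
  induction h with
  | discard hM κ => exact h1 _ hM κ
  | flow hT hF h ih =>
    exact h2 _ _ _ _ _ hT hF.contMDiffOn hF.isSmoothEmbedding hF.mem_cyl hF.isSpacelikeImmersion hF.isUnitNormal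
      hF.normal_tangent hF.contMDiff_normal hF.velocity_eq ih
  | of_diffeomorph h e ih => exact h3 _ _ _ e ih
  | cut κ D₁ D₂ hdisj hcover κ₁ κ₂ h₁ h₂ ih₁ ih₂ => exact h4 _ κ _ D₁ D₂ hdisj hcover κ₁ κ₂ ih₁ ih₂
  | cutNonseparating κ hψ hψo hns κ' h ih => exact h5 _ κ _ hψ hψo hns κ' ih
  | immortal hF hsep hthin => exact h6 _ _ _ _ hF hsep hthin

/-- **Registered helper `helper_cylinderSurgeryResolutionOfPocketPort` (lead c9): THE POCKET PORT GIVES THE ROUTE ITEM X₁.**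
If, for every compact connected `M` and every thin end-separating embedding `ι : M → N`, either some slice of `M` is
`CylNeckSurgeryResolvable` or a null survivor WITH POCKETS exists (an immortal smooth cylinder flow of a compact connected carrier,
`λ_cyl < 2`, slices never separating the ends, each slice with a pocket), then `CylinderSurgeryResolution` (item 18045) holds: null
survivors die (`helper_nullSurvivorsDiePocket`, p150352) and a resolved slice lies in the least rule-closed predicate
(`leastPredicate_of_cylNeckSurgeryResolvable`).  So item 18045 needs ONE research stub (the displayed hypothesis), not two.
[cite: ChodoshMantoulidisSchulze2025, Thm. 1.13 and Cor. 1.19] [cite: DanielsHolgate2022, Thm. 1.3] -/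
theorem helper_cylinderSurgeryResolutionOfPocketPort :
    (∀ (M : Type) [TopologicalSpace M] [T2Space M] [SecondCountableTopology M] [ChartedSpace (EuclideanSpace ℝ (Fin 4))
      M] [IsManifold (𝓡 4) ∞ M] [CompactSpace M] [ConnectedSpace M] (ι : M → EuclideanSpace ℝ (Fin 6)),
      Manifold.IsSmoothEmbedding (𝓡 4) (𝓡 6) ∞ ι → (∀ x, ∑ i : Fin 5, ι x (Fin.castSucc i) ^ 2 = 1) → SeparatesEnds
      (Set.range ι) → cylEntropy (Set.range ι) < ENNReal.ofReal (4 / Real.exp 1) → (∃ κ : M → EuclideanSpace ℝ (Fin 6),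
      CylNeckSurgeryResolvable M κ) ∨ ∃ (P : Type) (_ : TopologicalSpace P) (_ : T2Space P) (_ : SecondCountableTopology
      P) (_ : ChartedSpace (EuclideanSpace ℝ (Fin 4)) P) (_ : IsManifold (𝓡 4) ∞ P) (_ : CompactSpace P) (_ :
      ConnectedSpace P) (_ : MeasurableSpace P) (_ : BorelSpace P) (F : ℝ → P → EuclideanSpace ℝ (Fin 6)) (ν : ℝ → P →
      EuclideanSpace ℝ (Fin 6)) (T : ℝ), IsCylinderMCF P F ν T ∧ (∀ t, T ≤ t → cylEntropy (Set.range (F t)) < 2) ∧ (∀ t,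
      T ≤ t → ¬ SeparatesEnds (Set.range (F t))) ∧ (∀ t, T ≤ t → ∃ (z : EuclideanSpace ℝ (Fin 6)) (R : ℝ), ∑ i : Fin 5, z
      (Fin.castSucc i) ^ 2 = 1 ∧ z ∉ Set.range (F t) ∧ ∀ b : EuclideanSpace ℝ (Fin 6), ∑ i : Fin 5, b (Fin.castSucc i) ^
      2 = 1 → b 5 ≤ -R → ¬ JoinedIn ({z : EuclideanSpace ℝ (Fin 6) | ∑ i : Fin 5, z (Fin.castSucc i) ^ 2 = 1} \ Set.range
      (F t)) z b)) → Summit.SmoothPoincare4.SmoothPoincare4.Theses.CylinderEntropy.CylinderSurgeryResolution := by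
  intro hport M _ _ _ _ _ _ _ ι hι hN hsep hent
  rcases hport M ι hι hN hsep hent with ⟨κ, hκ⟩ | hnull
  · exact ⟨κ, leastPredicate_of_cylNeckSurgeryResolvable hκ⟩
  · exact absurd hnull helper_nullSurvivorsDiePocket

/-- **The pocket port gives X₁, hypothesis-style** (the registered helper with the port as a named hypothesis).  If, for every compact connected `M` and every thin end-separating embedding
`ι : M → N`, either some slice of `M` is `CylNeckSurgeryResolvable` or a null survivor WITH POCKETS exists (the hypothesis,
displayed: an immortal smooth cylinder flow of a compact connected carrier, `λ_cyl < 2`, slices never separating the ends, each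
slice with a pocket), then `CylinderSurgeryResolution` holds: null survivors die (`helper_nullSurvivorsDiePocket`, p150352) and a
resolved slice lies in the least rule-closed predicate.  So item 18045 needs ONE research stub (this hypothesis), not two.
[cite: ChodoshMantoulidisSchulze2025, Thm. 1.13 and Cor. 1.19] [cite: DanielsHolgate2022, Thm. 1.3] -/
theorem cylinderSurgeryResolution_of_pocketPort
    (hport : ∀ (M : Type) [TopologicalSpace M] [T2Space M] [SecondCountableTopology M]
      [ChartedSpace (EuclideanSpace ℝ (Fin 4)) M] [IsManifold (𝓡 4) ∞ M] [CompactSpace M] [ConnectedSpace M]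
      (ι : M → EuclideanSpace ℝ (Fin 6)), Manifold.IsSmoothEmbedding (𝓡 4) (𝓡 6) ∞ ι →
      (∀ x, ∑ i : Fin 5, ι x (Fin.castSucc i) ^ 2 = 1) → SeparatesEnds (Set.range ι) →
      cylEntropy (Set.range ι) < ENNReal.ofReal (4 / Real.exp 1) →
      (∃ κ : M → EuclideanSpace ℝ (Fin 6), CylNeckSurgeryResolvable M κ) ∨
        ∃ (P : Type) (_ : TopologicalSpace P) (_ : T2Space P) (_ : SecondCountableTopology P)
          (_ : ChartedSpace (EuclideanSpace ℝ (Fin 4)) P) (_ : IsManifold (𝓡 4) ∞ P) (_ : CompactSpace P)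
          (_ : ConnectedSpace P) (_ : MeasurableSpace P) (_ : BorelSpace P)
          (F : ℝ → P → EuclideanSpace ℝ (Fin 6)) (ν : ℝ → P → EuclideanSpace ℝ (Fin 6)) (T : ℝ),
          IsCylinderMCF P F ν T ∧ (∀ t, T ≤ t → cylEntropy (Set.range (F t)) < 2) ∧
            (∀ t, T ≤ t → ¬ SeparatesEnds (Set.range (F t))) ∧
            (∀ t, T ≤ t → ∃ (z : EuclideanSpace ℝ (Fin 6)) (R : ℝ), ∑ i : Fin 5, z (Fin.castSucc i) ^ 2 = 1 ∧
              z ∉ Set.range (F t) ∧ ∀ b : EuclideanSpace ℝ (Fin 6), ∑ i : Fin 5, b (Fin.castSucc i) ^ 2 = 1 → b 5 ≤ -R →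
                ¬ JoinedIn ({z : EuclideanSpace ℝ (Fin 6) | ∑ i : Fin 5, z (Fin.castSucc i) ^ 2 = 1} \ Set.range (F t)) z b)) :
    CylinderSurgeryResolution :=
  helper_cylinderSurgeryResolutionOfPocketPort hport

/-- **The converse**: `CylinderSurgeryResolution` gives the pocket port (its first disjunct, by the landed
`resolvable_of_surgeryResolution`). [cite: DanielsHolgate2022, §2.1 Def. 2.18–2.20] -/
theorem pocketPort_of_cylinderSurgeryResolution (hX : CylinderSurgeryResolution) :
    ∀ (M : Type) [TopologicalSpace M] [T2Space M] [SecondCountableTopology M]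
      [ChartedSpace (EuclideanSpace ℝ (Fin 4)) M] [IsManifold (𝓡 4) ∞ M] [CompactSpace M] [ConnectedSpace M]
      (ι : M → EuclideanSpace ℝ (Fin 6)), Manifold.IsSmoothEmbedding (𝓡 4) (𝓡 6) ∞ ι →
      (∀ x, ∑ i : Fin 5, ι x (Fin.castSucc i) ^ 2 = 1) → SeparatesEnds (Set.range ι) →
      cylEntropy (Set.range ι) < ENNReal.ofReal (4 / Real.exp 1) →
      (∃ κ : M → EuclideanSpace ℝ (Fin 6), CylNeckSurgeryResolvable M κ) ∨
        ∃ (P : Type) (_ : TopologicalSpace P) (_ : T2Space P) (_ : SecondCountableTopology P)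
          (_ : ChartedSpace (EuclideanSpace ℝ (Fin 4)) P) (_ : IsManifold (𝓡 4) ∞ P) (_ : CompactSpace P)
          (_ : ConnectedSpace P) (_ : MeasurableSpace P) (_ : BorelSpace P)
          (F : ℝ → P → EuclideanSpace ℝ (Fin 6)) (ν : ℝ → P → EuclideanSpace ℝ (Fin 6)) (T : ℝ),
          IsCylinderMCF P F ν T ∧ (∀ t, T ≤ t → cylEntropy (Set.range (F t)) < 2) ∧
            (∀ t, T ≤ t → ¬ SeparatesEnds (Set.range (F t))) ∧
            (∀ t, T ≤ t → ∃ (z : EuclideanSpace ℝ (Fin 6)) (R : ℝ), ∑ i : Fin 5, z (Fin.castSucc i) ^ 2 = 1 ∧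
              z ∉ Set.range (F t) ∧ ∀ b : EuclideanSpace ℝ (Fin 6), ∑ i : Fin 5, b (Fin.castSucc i) ^ 2 = 1 → b 5 ≤ -R →
                ¬ JoinedIn ({z : EuclideanSpace ℝ (Fin 6) | ∑ i : Fin 5, z (Fin.castSucc i) ^ 2 = 1} \ Set.range (F t)) z b) :=
  fun M _ _ _ _ _ _ _ ι hι hN hsep hent => Or.inl (resolvable_of_surgeryResolution hX M ι hι hN hsep hent)

/-- **X₁ ⇔ the pocket port** (the route item `CylinderSurgeryResolution` is exactly one research statement, kernel-checked both
ways). [cite: ChodoshMantoulidisSchulze2025, Thm. 1.13] [cite: DanielsHolgate2022, Thm. 1.3] -/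
theorem cylinderSurgeryResolution_iff_pocketPort :
    CylinderSurgeryResolution ↔
    ∀ (M : Type) [TopologicalSpace M] [T2Space M] [SecondCountableTopology M]
      [ChartedSpace (EuclideanSpace ℝ (Fin 4)) M] [IsManifold (𝓡 4) ∞ M] [CompactSpace M] [ConnectedSpace M]
      (ι : M → EuclideanSpace ℝ (Fin 6)), Manifold.IsSmoothEmbedding (𝓡 4) (𝓡 6) ∞ ι →
      (∀ x, ∑ i : Fin 5, ι x (Fin.castSucc i) ^ 2 = 1) → SeparatesEnds (Set.range ι) →
      cylEntropy (Set.range ι) < ENNReal.ofReal (4 / Real.exp 1) →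
      (∃ κ : M → EuclideanSpace ℝ (Fin 6), CylNeckSurgeryResolvable M κ) ∨
        ∃ (P : Type) (_ : TopologicalSpace P) (_ : T2Space P) (_ : SecondCountableTopology P)
          (_ : ChartedSpace (EuclideanSpace ℝ (Fin 4)) P) (_ : IsManifold (𝓡 4) ∞ P) (_ : CompactSpace P)
          (_ : ConnectedSpace P) (_ : MeasurableSpace P) (_ : BorelSpace P)
          (F : ℝ → P → EuclideanSpace ℝ (Fin 6)) (ν : ℝ → P → EuclideanSpace ℝ (Fin 6)) (T : ℝ),
          IsCylinderMCF P F ν T ∧ (∀ t, T ≤ t → cylEntropy (Set.range (F t)) < 2) ∧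
            (∀ t, T ≤ t → ¬ SeparatesEnds (Set.range (F t))) ∧
            (∀ t, T ≤ t → ∃ (z : EuclideanSpace ℝ (Fin 6)) (R : ℝ), ∑ i : Fin 5, z (Fin.castSucc i) ^ 2 = 1 ∧
              z ∉ Set.range (F t) ∧ ∀ b : EuclideanSpace ℝ (Fin 6), ∑ i : Fin 5, b (Fin.castSucc i) ^ 2 = 1 → b 5 ≤ -R →
                ¬ JoinedIn ({z : EuclideanSpace ℝ (Fin 6) | ∑ i : Fin 5, z (Fin.castSucc i) ^ 2 = 1} \ Set.range (F t)) z b) :=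
  ⟨pocketPort_of_cylinderSurgeryResolution, cylinderSurgeryResolution_of_pocketPort⟩

/-- **The crux's end state re-based on the pocket port**: `CylinderRungTwo ⇐ PocketPortAll (research) + Cor. 1.5 (b) (published)
+ the kernel certificates (landed computationally)` — the pocket port gives X₁ (`cylinderSurgeryResolution_of_pocketPort`), and the
landed port reduction `cylinderRungTwo_of_resolution_cor15b_certificates` (p151490) concludes.
[cite: ChodoshMantoulidisSchulze2025, Thm. 1.13 and Cor. 1.5 (b)] [cite: DanielsHolgate2022, Thm. 1.3] -/
theorem cylinderRungTwo_of_pocketPort_cor15b_certificates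
    (hport : ∀ (M : Type) [TopologicalSpace M] [T2Space M] [SecondCountableTopology M]
      [ChartedSpace (EuclideanSpace ℝ (Fin 4)) M] [IsManifold (𝓡 4) ∞ M] [CompactSpace M] [ConnectedSpace M]
      (ι : M → EuclideanSpace ℝ (Fin 6)), Manifold.IsSmoothEmbedding (𝓡 4) (𝓡 6) ∞ ι →
      (∀ x, ∑ i : Fin 5, ι x (Fin.castSucc i) ^ 2 = 1) → SeparatesEnds (Set.range ι) →
      cylEntropy (Set.range ι) < ENNReal.ofReal (4 / Real.exp 1) →
      (∃ κ : M → EuclideanSpace ℝ (Fin 6), CylNeckSurgeryResolvable M κ) ∨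
        ∃ (P : Type) (_ : TopologicalSpace P) (_ : T2Space P) (_ : SecondCountableTopology P)
          (_ : ChartedSpace (EuclideanSpace ℝ (Fin 4)) P) (_ : IsManifold (𝓡 4) ∞ P) (_ : CompactSpace P)
          (_ : ConnectedSpace P) (_ : MeasurableSpace P) (_ : BorelSpace P)
          (F : ℝ → P → EuclideanSpace ℝ (Fin 6)) (ν : ℝ → P → EuclideanSpace ℝ (Fin 6)) (T : ℝ),
          IsCylinderMCF P F ν T ∧ (∀ t, T ≤ t → cylEntropy (Set.range (F t)) < 2) ∧
            (∀ t, T ≤ t → ¬ SeparatesEnds (Set.range (F t))) ∧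
            (∀ t, T ≤ t → ∃ (z : EuclideanSpace ℝ (Fin 6)) (R : ℝ), ∑ i : Fin 5, z (Fin.castSucc i) ^ 2 = 1 ∧
              z ∉ Set.range (F t) ∧ ∀ b : EuclideanSpace ℝ (Fin 6), ∑ i : Fin 5, b (Fin.castSucc i) ^ 2 = 1 → b 5 ≤ -R →
                ¬ JoinedIn ({z : EuclideanSpace ℝ (Fin 6) | ∑ i : Fin 5, z (Fin.castSucc i) ^ 2 = 1} \ Set.range (F t)) z b))
    (hb : Literature.Geometry.Riemannian.ChodoshMantoulidisSchulze2025_cor15b_four)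
    (hcert : ∀ T : ℝ, 1 / 100 ≤ T → T ≤ 10 →
      ∃ (n : ℕ) (σ τ w : Fin n → ℝ) (c : ℝ), (∀ j, 0 < τ j) ∧ (∀ j, 0 ≤ w j) ∧ 0 ≤ c ∧ (∑ j, w j) + c ≤ 147 / 100 ∧
        ∀ u s : ℝ, -1 ≤ s → s ≤ 1 →
          (8 * Real.pi ^ 2 / 3) * ((4 * Real.pi * T) ^ 2)⁻¹ * Real.exp (4 * u) *
              Real.exp (-(Real.exp (2 * u) - 2 * Real.exp u * s + 1) / (4 * T)) ≤
            (∑ j, w j * (Literature.Geometry.Riemannian.SphericalCylinderEntropy.zonal (τ j) s *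
              Real.exp (-(u - σ j) ^ 2 / (4 * τ j)))) + c) :
    CylinderRungTwo :=
  cylinderRungTwo_of_resolution_cor15b_certificates (cylinderSurgeryResolution_of_pocketPort hport) hb hcert

end Summit.SmoothPoincare4.SmoothPoincare4.Cruxes.CylinderRungTwo.KillingFlux

end
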